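import Summits.NavierStokesRegularity.FluidComputer.GateBudgetLadderPair
import Summits.NavierStokesRegularity.FluidComputer.GateBudgetDudHorizonSharp
import HarnessLib

/-!
# GateBudget part 98 — the clean dud horizon on the √P pair ledger (§273)

Cell `pub-fluidc`, blueprint seat bp1 (gen 38, SPEC-INPUT-bp1 §BT(3)); namespace
`Summit.NavierStokesRegularity.FluidComputer.GateBudget`, headline member
`RotorKnob.rotorCircuit K K¹⁰ ε ρ` of the two-scale family from `delayInit` (5.6), `K ≥ 16`, on
the lattice window `200ε/K²⁰ ≤ ρ² ≤ 2ε/K¹⁰`, `ε² ≤ 1/(6K²⁰)`, `ε = kK¹⁰ρ²` with `k ≤ K²`; modes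
`0 = a` (carrier), `1 = b` (clock), `2 = c` (trigger), `3 = d` (transfer), `4 = ã` (output).
HONEST FRAMING: a low prior, high value-of-information experiment on Tao's machine paradigm; NOT
a claim that NS blows up.

WHAT. Part 95 §269 is the clean dud horizon on the LINEAR pair ledger: `ã ≤ 0.1415` on `[0,
1.8282 + N]` for every `N ≥ 1` with `(N - 1)(1.1 + k²/10)/K⁹ ≤ 0.0199` (`N - 1 ≤ 0.01658K⁹` at
`k = 1`). §273 runs part 97 §272's √P ladder from part 86 §241's member-wise anchor (`√P₁ =
|d|-ledger start ≤ 7/K⁴`) on part 86's ledgers `D = 7/K⁴`, `U = 7/2 + k²/3 + 10⁻³` with the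
ã-free slip `δ₀ = (14/K⁴ + ι)ι + 6(7/K⁴ + ι + 3/K⁹)/K⁹` (`ι = (2k + 3)/(5K⁹)`), whose log
coefficient is `δ₀K⁹/2 ≤ (14k + 127)/(5K⁴)` (part 96 §271): `knob_misfire_ladder_pair` — for
every `N` in the √-WINDOW `(N - 1)(7/2 + k²/3 + 10⁻³)/K⁹ + (14k + 127) log N/(5K⁴) ≤ 0.1409`
and every `1 ≤ n ≤ N` a normal-form ignition `rₙ > 1.8282 + n` with `5/4 ≤ θₙ ≤ 29/20`,
`√P(rₙ) ≤ 7/K⁴ + (n - 1)(7/2 + k²/3 + 10⁻³)/K⁹ + (14k + 127) log n/(5K⁴)`, `P(rₙ) ≤ 1/50`,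
`(n - 1)/K⁹ ≤ ã(rₙ) ≤ 0.1415`, `|d(rₙ)| ≤ 7/K⁴`; `knob_ladder_no_output_pair` — `ã ≤ 0.1415`
on `[0, 1.8282 + N]`; `knob_ladder_no_output_pair_explicit` — the same under the log-free
window `(N - 1)(7/2 + k²/3 + 10⁻³)/K⁹ + 9(14k + 127) log K/(5K⁴) ≤ 0.1409` (`N ≤ K⁹`).
NUMBERS (`K = 16`): `k = 1`: `N - 1 ≤ 0.0343K⁹ = 2.36·10⁹` clean rungs (log-free form
`0.0339K⁹`), against part 95's `0.01658K⁹` (×2.07) and part 72's forced ceiling `0.1415K⁹ + 1`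
(a factor `4.1`; `3.85` as `K → ∞`, where the window tends to `0.1409K⁹/U = 0.0367K⁹`); `k =
2`: `0.0270K⁹` (part 95: `0.0133K⁹`); `k = 6`: `0.0083K⁹` (part 95: `0.0042K⁹`). The
remaining factor is exactly the pulse gain `U ≈ 3.83` of the output per rung (part 82 §239)
against the injection floor `1` per rung of the necessity side (part 72).
HOW. Part 97 §272 `knob_ladder_pair` with `r₀ = r₁`, `θ₀ = θ₁ ∈ [1.394, 1.44]`, `P₁ = D₀²`,
`A₀ = 0`, `D₀ = ψ₁ + 245/K⁸ ≤ 7/K⁴` (part 86 §242), `δ = δ₀`, `L` the sharp loss (part 89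
§258: `L ≤ 42/K⁹`); the √-window of §272 from the closed-form one by part 96 §271
`pair_ledger_numerics` (`√P₁ ≤ 7/K⁴`, `s′ ≤ 10⁻⁴`, `δ₀ ≤ (1.1 + k²/10)/K⁹` by part 85 §250) and
`N - 1 ≤ K⁹` by §271 `pair_window_coarse_sqrt`; then `RotorKnob.rotorCircuit_output_monotone`.
HONEST LIMITS. (i) `k ≤ K²` as in parts 86/95; (ii) the horizon is still PAIR-limited, now by
the pulse gain `U` rather than by the terminal-output pricing — the factor `≈ 4` to part 72's
ceiling is NOT closed here; (iii) existence of the rungs, no uniqueness; (iv) nothing about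
Navier–Stokes.
[cite: Tao2016AveragedNS, §5.5 Theorem 5.3, (5.5), (5.6), (b-eq), (c-eq), (d-eq), (ta-eq),
(energy-con), (est)]
-/

noncomputable section

namespace Summit.NavierStokesRegularity.FluidComputer.GateBudget

open Real Set Filter Topology
open Literature.Analysis.FluidPDE.Tao2016AveragedNS

variable {K ε ρ : ℝ} {X : ℝ → Fin 5 → ℝ} {C : ℝ → ℝ}

/-! ## §273 The misfire ladder inside the √-window -/

/-- §273 **THE MISFIRE LADDER AT EVERY WINDING ON THE √P LEDGER** (headline member from
`delayInit` with a trigger primitive, `K ≥ 16`, `0 < ε`, `ε² ≤ 1/(6K²⁰)`, `0 < ρ`, `200ε/K²⁰ ≤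
ρ²`, `K¹⁰ρ² ≤ 2ε`, `ε = kK¹⁰ρ²`, `k ≤ K²`): for every `N` in the √-window `(N - 1)(7/2 + k²/3 +
10⁻³)/K⁹ + (14k + 127) log N/(5K⁴) ≤ 0.1409` and every `1 ≤ n ≤ N` there is a normal-form
ignition `rₙ > 1.8282 + n` with `5/4 ≤ θₙ ≤ 29/20`, `√P(rₙ) ≤ 7/K⁴ + (n - 1)(7/2 + k²/3 +
10⁻³)/K⁹ + (14k + 127) log n/(5K⁴)`, `P(rₙ) ≤ 1/50`, `(n - 1)/K⁹ ≤ ã(rₙ) ≤ 0.1415`, `|d(rₙ)| ≤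
7/K⁴`. [derived: part 97 §272, part 96 §271, part 86 §241–§242, part 85 §250, part 89 §258] -/
theorem knob_misfire_ladder_pair
    (hX : ∀ t, HasDerivAt X (RotorKnob.rotorCircuit K (K ^ 10) ε ρ (X t)) t)
    (h0 : X 0 = delayInit) (hC : ∀ t, HasDerivAt C (X t 2) t) (hK : 16 ≤ K)
    (hε : 0 < ε) (hεK : ε ^ 2 ≤ 1 / (6 * K ^ 20)) (hρ : 0 < ρ)
    (hlo : 200 * ε / K ^ 20 ≤ ρ ^ 2) (hhi : K ^ 10 * ρ ^ 2 ≤ 2 * ε) (k : ℕ)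
    (hk : ε = k * K ^ 10 * ρ ^ 2) (hkK : (k : ℝ) ≤ K ^ 2) (N : ℕ)
    (hNW : ((N : ℝ) - 1) * ((7 / 2 + k ^ 2 / 3 + 1 / 1000) / K ^ 9)
      + (14 * k + 127) / (5 * K ^ 4) * log N ≤ 1409 / 10000) :
    ∀ n : ℕ, 1 ≤ n → n ≤ N → ∃ r θ : ℝ, 18282 / 10000 + n < r ∧ X r 1 = θ * ε ∧
      5 / 4 ≤ θ ∧ θ ≤ 29 / 20 ∧ X r 2 = ρ ^ 2 / K ^ 9 ∧
      √(X r 3 ^ 2 + X r 4 ^ 2) ≤ 7 / K ^ 4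
        + ((n : ℝ) - 1) * ((7 / 2 + k ^ 2 / 3 + 1 / 1000) / K ^ 9)
        + (14 * k + 127) / (5 * K ^ 4) * log n ∧
      X r 3 ^ 2 + X r 4 ^ 2 ≤ 1 / 50 ∧
      ((n : ℝ) - 1) / K ^ 9 ≤ X r 4 ∧ X r 4 ≤ 1415 / 10000 ∧ |X r 3| ≤ 7 / K ^ 4 := by
  obtain ⟨r₁, θ₁, hr1, hb1, hθlo, hθhi, hc1, he0, hP1, hd1, hk1⟩ :=
    knob_ladder_anchor_member hX h0 hC hK hε hεK hρ hlo hhi k hk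
  obtain ⟨hD, hU, -, -, hres⟩ := two_sided_numerics hK hk1 hkK
  have hS := clock_slip_numerics hK hk1 hkK
  obtain ⟨hL0, hL42⟩ := sharp_loss_numerics hK hk1 hkK
  obtain ⟨hcL, hwin⟩ := pair_ledger_numerics hK hk1 hkK
  have hK0 : (0 : ℝ) < K := by linarith
  have hK4 : (0 : ℝ) < K ^ 4 := by positivity
  have hK9 : (0 : ℝ) < K ^ 9 := by positivity
  have hk0 : (0 : ℝ) ≤ k := Nat.cast_nonneg k
  obtain ⟨e₁, he₁_def⟩ : ∃ e₁ : ℝ,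
      e₁ = k * π / (49 / 100 * K ^ 10 - 1) + 2 / K ^ 10 + 245 / K ^ 8 := ⟨_, rfl⟩
  obtain ⟨δ₀, hδ₀_def⟩ : ∃ δ₀ : ℝ,
      δ₀ = (2 * (7 / K ^ 4) + (2 * k + 3) / (5 * K ^ 9)) * ((2 * k + 3) / (5 * K ^ 9))
        + 6 * (7 / K ^ 4 + (2 * k + 3) / (5 * K ^ 9) + 3 / K ^ 9) / K ^ 9 := ⟨_, rfl⟩
  obtain ⟨u, hu_def⟩ : ∃ u : ℝ, u = (7 / 2 + k ^ 2 / 3 + 1 / 1000) / K ^ 9 := ⟨_, rfl⟩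
  obtain ⟨cM, hcM_def⟩ : ∃ cM : ℝ, cM = (14 * k + 127) / (5 * K ^ 4) := ⟨_, rfl⟩
  rw [← he₁_def] at hP1 hd1 hD hres
  rw [← hδ₀_def] at hcL
  have he₁0 : 0 ≤ e₁ := (abs_nonneg _).trans hd1
  have hsq₁ : √(e₁ ^ 2) = e₁ := Real.sqrt_sq he₁0
  have he₁7 : e₁ ≤ 7 / K ^ 4 := by
    have hJ : 0 ≤ (1 + 10 / 9 * K ^ 4) * ((61 / 12 * k + 2 / 3) / K ^ 10 + 3 / K ^ 9) := by
      positivity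
    linarith only [hD, hJ]
  have hu0 : 0 ≤ u := by rw [hu_def]; positivity
  have hδ₀0 : 0 ≤ δ₀ := by rw [hδ₀_def]; positivity
  have hδS : δ₀ ≤ (11 / 10 + k ^ 2 / 10) / K ^ 9 := by
    have h0 : 0 ≤ (2829 / 10000 + (7 / 2 + k ^ 2 / 3 + 1 / 1000) / K ^ 9)
        * ((7 / 2 + k ^ 2 / 3 + 1 / 1000) / K ^ 9) := by positivity
    rw [hδ₀_def]; linarith only [hS, h0]
  have hcM0 : 0 ≤ cM := by rw [hcM_def]; positivity
  have hθ₀lo : 139 / 100 - (242 * log K / K ^ 10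
        + 37 * (7 / K ^ 4 + (2 * k + 3) / (5 * K ^ 9) + 4 / K ^ 9) / K ^ 9) ≤ θ₁ := by
    linarith only [hL0, hθlo]
  simp only [← hu_def, ← hcM_def] at hNW hcL ⊢
  intro n hn hnN
  have hn1 : (1 : ℝ) ≤ n := by exact_mod_cast hn
  have hN1 : (1 : ℝ) ≤ N := by exact_mod_cast hn.trans hnN
  have hlogN : 0 ≤ log (N : ℝ) := Real.log_nonneg hN1
  have hlogn : 0 ≤ log (n : ℝ) := Real.log_nonneg hn1
  have hcMN : 0 ≤ cM * log N := mul_nonneg hcM0 hlogN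
  -- `N - 1 ≤ K⁹` from the √-window (part 96 §271)
  have hN9 : (N : ℝ) - 1 ≤ K ^ 9 := by
    refine pair_window_coarse_sqrt hK (k := (k : ℝ)) ?_
    rw [← hu_def]; linarith only [hNW, hcMN]
  -- the √-window of part 97 §272 from the closed-form one (part 96 §271)
  have hcLN : δ₀ * K ^ 9 / 2 * log N ≤ cM * log N := mul_le_mul_of_nonneg_right hcL hlogN
  have hW0 : 0 ≤ √(e₁ ^ 2) + ((N : ℝ) - 1) * u + δ₀ * K ^ 9 / 2 * log N := by
    rw [hsq₁]
    have h1 : 0 ≤ ((N : ℝ) - 1) * u := mul_nonneg (by linarith only [hN1]) hu0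
    have h2 : 0 ≤ δ₀ * K ^ 9 / 2 * log N := mul_nonneg (by positivity) hlogN
    linarith only [he₁0, h1, h2]
  have hWle : √(e₁ ^ 2) + ((N : ℝ) - 1) * u + δ₀ * K ^ 9 / 2 * log N
      ≤ 7 / K ^ 4 + 1409 / 10000 := by
    rw [hsq₁]; linarith only [he₁7, hNW, hcLN]
  have hW2 := pow_le_pow_left₀ hW0 hWle 2
  have hNW' : (√(e₁ ^ 2) + ((N : ℝ) - 1) * u + δ₀ * K ^ 9 / 2 * log N) ^ 2
      + (3 * (k * π / ((25 / 16 - 1 / 10 ^ 6) * K ^ 10 - 1) + 1 / K ^ 19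
        + 310 * log K / K ^ 9) / 10 + 6 / K ^ 9) + δ₀ ≤ 1 / 50 := by
    nlinarith only [hW2, hres, sq_nonneg e₁, hδS, hwin]
  obtain ⟨r, θ, hr, hb, hθ1, hθ2, hc, hW, hP50, hA, ha, hd⟩ := knob_ladder_pair hX h0 hC hK
    hε hεK hρ hlo hhi k hk (le_of_lt (by linarith only [hr1])) hb1 hc1 hP1 hθ₀lo
    (by linarith only [hθhi]) hL42 hN9 le_rfl he0 hd1 hD hU (le_of_eq hδ₀_def.symm) le_rfl
    (by rw [← hu_def]; exact hNW') n hn hnN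
  refine ⟨r, θ, by linarith only [hr, hr1], hb, hθ1, hθ2, hc, ?_, hP50, by simpa using hA, ha,
    by linarith only [hd, he₁7]⟩
  have hcLn : δ₀ * K ^ 9 / 2 * log n ≤ cM * log n := mul_le_mul_of_nonneg_right hcL hlogn
  rw [hsq₁, ← hu_def] at hW
  linarith only [hW, he₁7, hcLn]

/-- §273 **NO OUTPUT INSIDE THE √-WINDOW** (headline member, `K ≥ 16`, lattice `ε = kK¹⁰ρ²`
with `k ≤ K²`, any `N ≥ 1` with `(N - 1)(7/2 + k²/3 + 10⁻³)/K⁹ + (14k + 127) log N/(5K⁴) ≤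
0.1409`): `ã(t) ≤ 0.1415` for all `t ∈ [0, 1.8282 + N]` — the machine misfires cleanly for `≈
0.034K⁹` windings (`k = 1`, `K = 16`; `0.0367K⁹` as `K → ∞`), twice part 95 §269's horizon, and
never delivers. [derived: this file §273, part 9] -/
theorem knob_ladder_no_output_pair
    (hX : ∀ t, HasDerivAt X (RotorKnob.rotorCircuit K (K ^ 10) ε ρ (X t)) t)
    (h0 : X 0 = delayInit) (hC : ∀ t, HasDerivAt C (X t 2) t) (hK : 16 ≤ K)
    (hε : 0 < ε) (hεK : ε ^ 2 ≤ 1 / (6 * K ^ 20)) (hρ : 0 < ρ)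
    (hlo : 200 * ε / K ^ 20 ≤ ρ ^ 2) (hhi : K ^ 10 * ρ ^ 2 ≤ 2 * ε) (k : ℕ)
    (hk : ε = k * K ^ 10 * ρ ^ 2) (hkK : (k : ℝ) ≤ K ^ 2) (N : ℕ) (hN1 : 1 ≤ N)
    (hNW : ((N : ℝ) - 1) * ((7 / 2 + k ^ 2 / 3 + 1 / 1000) / K ^ 9)
      + (14 * k + 127) / (5 * K ^ 4) * log N ≤ 1409 / 10000) :
    ∀ t ∈ Icc (0 : ℝ) (18282 / 10000 + N), X t 4 ≤ 1415 / 10000 := by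
  have hK0 : (0 : ℝ) < K := by linarith
  obtain ⟨r, θ, hr, -, -, -, -, -, -, -, ha, -⟩ :=
    knob_misfire_ladder_pair hX h0 hC hK hε hεK hρ hlo hhi k hk hkK N hNW N hN1 le_rfl
  intro t ht
  exact (RotorKnob.rotorCircuit_output_monotone hK0.le hX (by linarith only [ht.2, hr])).trans ha

/-- §273 **NO OUTPUT INSIDE THE LOG-FREE √-WINDOW** (headline member, `K ≥ 16`, lattice `ε =
kK¹⁰ρ²` with `k ≤ K²`, any `N ≥ 1` with `(N - 1)(7/2 + k²/3 + 10⁻³)/K⁹ + 9(14k + 127) log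
K/(5K⁴) ≤ 0.1409`): `ã(t) ≤ 0.1415` for all `t ∈ [0, 1.8282 + N]` (the window forces `N ≤ K⁹`,
so `log N ≤ 9 log K`). At `K = 16`, `k = 1`: `N - 1 ≤ 0.0339K⁹ = 2.33·10⁹`.
[derived: this file §273] -/
theorem knob_ladder_no_output_pair_explicit
    (hX : ∀ t, HasDerivAt X (RotorKnob.rotorCircuit K (K ^ 10) ε ρ (X t)) t)
    (h0 : X 0 = delayInit) (hC : ∀ t, HasDerivAt C (X t 2) t) (hK : 16 ≤ K)
    (hε : 0 < ε) (hεK : ε ^ 2 ≤ 1 / (6 * K ^ 20)) (hρ : 0 < ρ)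
    (hlo : 200 * ε / K ^ 20 ≤ ρ ^ 2) (hhi : K ^ 10 * ρ ^ 2 ≤ 2 * ε) (k : ℕ)
    (hk : ε = k * K ^ 10 * ρ ^ 2) (hkK : (k : ℝ) ≤ K ^ 2) (N : ℕ) (hN1 : 1 ≤ N)
    (hNL : ((N : ℝ) - 1) * ((7 / 2 + k ^ 2 / 3 + 1 / 1000) / K ^ 9)
      + (14 * k + 127) / (5 * K ^ 4) * (9 * log K) ≤ 1409 / 10000) :
    ∀ t ∈ Icc (0 : ℝ) (18282 / 10000 + N), X t 4 ≤ 1415 / 10000 := by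
  have hK0 : (0 : ℝ) < K := by linarith
  have hK9 : (0 : ℝ) < K ^ 9 := by positivity
  have hk0 : (0 : ℝ) ≤ k := Nat.cast_nonneg k
  have hN1' : (1 : ℝ) ≤ N := by exact_mod_cast hN1
  have hcM0 : 0 ≤ (14 * k + 127) / (5 * K ^ 4) := by positivity
  have hlogK : 0 ≤ log K := Real.log_nonneg (by linarith)
  have hNu : ((N : ℝ) - 1) * ((7 / 2 + k ^ 2 / 3 + 1 / 1000) / K ^ 9) ≤ 15 / 100 := by
    have := mul_nonneg hcM0 (mul_nonneg (by norm_num : (0 : ℝ) ≤ 9) hlogK)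
    linarith only [hNL, this]
  have hN9 : (N : ℝ) - 1 ≤ 15 / 100 * K ^ 9 := by
    have h1 : (1 : ℝ) / K ^ 9 ≤ (7 / 2 + k ^ 2 / 3 + 1 / 1000) / K ^ 9 :=
      div_le_div_of_nonneg_right (by nlinarith only [sq_nonneg (k : ℝ)]) hK9.le
    have h2 := mul_le_mul_of_nonneg_left h1 (by linarith only [hN1'] : (0 : ℝ) ≤ (N : ℝ) - 1)
    have h3 : ((N : ℝ) - 1) * (1 / K ^ 9) ≤ 15 / 100 := h2.trans hNu
    rw [mul_one_div, div_le_iff₀ hK9] at h3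
    exact h3
  have hK9big : (68719476736 : ℝ) ≤ K ^ 9 := by
    have := pow_le_pow_left₀ (by norm_num : (0 : ℝ) ≤ 16) hK 9; norm_num at this; exact this
  have hNK : (N : ℝ) ≤ K ^ 9 := by linarith only [hN9, hK9big]
  have hlogN : log (N : ℝ) ≤ 9 * log K := by
    have h := Real.log_le_log (by linarith only [hN1']) hNK
    have h9 : log (K ^ 9) = 9 * log K := by rw [Real.log_pow]; norm_num
    linarith only [h, h9]
  have hNW : ((N : ℝ) - 1) * ((7 / 2 + k ^ 2 / 3 + 1 / 1000) / K ^ 9)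
      + (14 * k + 127) / (5 * K ^ 4) * log N ≤ 1409 / 10000 := by
    have := mul_le_mul_of_nonneg_left hlogN hcM0
    linarith only [hNL, this]
  exact knob_ladder_no_output_pair hX h0 hC hK hε hεK hρ hlo hhi k hk hkK N hN1 hNW

end Summit.NavierStokesRegularity.FluidComputer.GateBudget

end
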